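import Literature.MathematicalPhysics.QuantumFieldTheory.Balaban1983to89.B13Bound226Numerals

/-!
# `Balaban1983to89.B13VolumeDialNumerals` — T. Bałaban, *Renormalization group approach to lattice gauge field theories. II. Cluster expansions*,
Commun. Math. Phys. **116** (1988) 1–22, doi:10.1007/bf01239022 [Balaban1988RG2Cluster]:
**THE VOLUME BINDER OF (2.24)–(2.26) FROM SIZE LAWS AND FOUR DIAL INEQUALITIES — the located form of p. 20's «O(1)(LM)⁴α₅ sufficiently small»**

statement-level skeleton of published theorems with citation tags; proofs where landed; nothing here is a claim about the
Yang–Mills mass gap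

CITATION HEADER (verbatim).  p. 17 [PDF 17], (2.24)–(2.26): the Gaussian bound of one term with the volume factor; p. 20 [PDF 20], before (2.37):
*"O(1)(LM)⁴α₅ + exp(−½(κ₁ − 1)) is sufficiently small"* — the per-cube volume letter is a product of the NUMBER of variables per cube (`(LM)⁴`-type)
and a SMALL constant; p. 21, closing paragraph: *"The assumptions allow finally us to fix all the constants, or rather bounds on these constants."*  NOT
PRINTED: the explicit inequalities below — located algebra on the typed volume binder.

WHY THIS FILE (cell `pub-ymgap`, node N10 = [B13], seat `pub-ymgap-dag-n10-w3` g4; own-stem successor of `B13CountBinderObstruction` (p612518) and of the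
dial-weighted junction edition «67V» (`Summits/…/BalabanUVNodesN10B13KernelTowerWalksEntrywiseNumeralsDecoratedDialsLocatedVol`)).  n10-w1's
`B13Bound226Numerals.vol_of_counts` bounds the DIAL-WEIGHTED volume binder `hvol` of the N10 junctions (coefficients `x(1 + (1−x)⁻¹)` with
`x = K_Cs·fib₃·ϑ·fib₁ ∝ θ₀`, `A·c_E`, `A·V` with `A = 2ϑ·fib₁ + γ₂ + 2m′α₄M⁻⁴(1 + 32∕(κ₁−1))⁴`) by FREEZING the coefficients at their worst cases `3∕2, ½, ½`
and asks for the θ-free count `2|Λ| + ½|Λ ⊕ C₀| + 2K₀α₄·#⋃𝐃 ≤ a₅|Z|`; `B13CountBinderObstruction` shows that count cannot be met jointly with `hPcard ∧ hN` at any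
typed constants family (`a₅ < δℓκ∕64 < 37` at the witnesses while the all-bonds term needs `a₅ ≥ 10(LM)⁴`).  THIS FILE is the OTHER reading of the same
left side: keep the coefficients as what they are — multiples of the DIALS `θ₀`, `γ₂`, `α₄M⁻⁴`, `α₄` — and charge the object SIZES to a per-cube multiple `V`
of `|Z|` (print's `(LM)⁴`-type count: row bonds, extra columns and 𝐃-cubes of a term are at most `V` per cube of `Z`).  Then `hvol` follows from FOUR product-form
dial inequalities — `4V(3Q + 2DQ′)·θ₀ ≤ a₅`, `8VD·γ₂ ≤ a₅`, `8VD·(2m′(1+32∕(κ₁−1))⁴α₄M⁻⁴) ≤ a₅`, `8V·K₀α₄ ≤ a₅` — which small dials satisfy for ANY `V`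
and ANY `a₅ > 0` (§2), with `θ₀ > 0`: exactly p. 20's mechanism.  A junction edition displaying these instead of `hvol` («67VL») is then a positional call
of 67V with `vol_of_dials` — NOT filed here.

WHAT THIS FILE PROVES (0 `sorry`, 0 `def`; theorems only; letters abstract as in `vol_of_counts`: `K0` for `K₀(64,8)`, `Λc ΛCc Uc Zc` the three sizes and
`|Z|` as reals, `V` the per-cube size letter).
§1 `detCoeff_le` (`x ≤ ½ ⟹ 2·(x(1 + (1−x)⁻¹)∕2) ≤ 3x`), `two_theta_fib_eq` (`2ϑ·fib₁ = θ₀·Q′`), ★★ `vol_of_dials` — the volume binder's left side (VERBATIM the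
   conclusion shape of `vol_of_counts`, i.e. the junction's `hvol` at one term) is `≤ a₅·|Z|` from the three size laws `Λc, ΛCc, Uc ≤ V·|Z|` (`Λc ≥ 0`), `θ₀ ≤ θ₀max`
   (for `x ≤ ½`) and the four dial inequalities.
§2 ★ `exists_dials_vol` — A6: for every `V ≥ 0`, `a₅ > 0` and every signed letter family there are `θ₀ > 0`, `γ₂ > 0`, `α₄ > 0` meeting the four dial
   inequalities TOGETHER WITH `θ₀ ≤ θ₀max`, `γ₂ ≤ γ₂max` (upper bounds only) — the dial-weighted volume binder never pins the constants record.

HONEST SCOPE.  Elementary real algebra on the typed left side of (2.24)–(2.26); which `V` the objects of record obey (`≤ 4(LM)⁴·3⁴` row bonds per cube of `Z` for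
print's terms) is object bookkeeping for the eventual joint inhabitant, NOT done here; nothing of Bałaban's asserted; `vol_of_counts` and every junction stand
TRUE AS STATED.  Count-neutral; N10 NOT discharged; K1⁷ NOT claimed; one finite four-torus programme at fixed ε; nothing continuum ∕ ℝ⁴ ∕ OS ∕ mass-gap ∕ Clay.
-/

noncomputable section

namespace Literature.MathematicalPhysics.QuantumFieldTheory.Balaban1983to89.B13VolumeDialNumerals

open Literature.MathematicalPhysics.QuantumFieldTheory.Balaban1983to89
open Literature.MathematicalPhysics.QuantumFieldTheory.Balaban1983to89.B13Bound226Numerals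

/-! ## §1. The volume binder from size laws and four dial inequalities -/

section Volume

variable (m ν m' : ℕ) {κs KG KCs θ₀ cE BΓ cV c0η mA γ₂ α₄ M κ₁ : ℝ}

/-- The determinant coefficient of the volume binder is at most `3x` once `x ≤ ½` (`(1−x)⁻¹ ≤ 2`). [cite: Balaban1988RG2Cluster, (2.24) p.17] -/
theorem detCoeff_le {x : ℝ} (hx0 : 0 ≤ x) (hx : x ≤ 1 / 2) : 2 * (x * (1 + (1 - x)⁻¹) / 2) ≤ 3 * x := by
  have hinv : (1 - x)⁻¹ ≤ 2 := by
    calc (1 - x)⁻¹ ≤ (1 / 2 : ℝ)⁻¹ := inv_anti₀ (by norm_num) (by linarith)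
      _ = 2 := by norm_num
  have h3 : x * (1 + (1 - x)⁻¹) ≤ x * 3 := mul_le_mul_of_nonneg_left (by linarith) hx0
  have e : 2 * (x * (1 + (1 - x)⁻¹) / 2) = x * (1 + (1 - x)⁻¹) := by ring
  rw [e]
  linarith

/-- `2ϑ·fib₁ = θ₀·Q′`: the θ₀-part of the letter `A` of (2.24)–(2.25) is the dial `θ₀` times the numeral `Q′ = 2(1 + K_Cs K_G fib²)²·fib`.
[cite: Balaban1988RG2Cluster, (2.24) p.17] -/
theorem two_theta_fib_eq :
    2 * (theta m ν κs KG KCs θ₀ * ((m : ℝ) * (1 + 2 / chainRate 1 κs) ^ ν)) = θ₀ * coefQ' m ν κs KG KCs := by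
  rw [fibFactor_1]
  unfold theta coefQ'
  ring

/-- ★★ **THE VOLUME BINDER FROM SIZE LAWS AND DIALS.**  The left side of the junction's dial-weighted volume binder at one term (VERBATIM the
conclusion shape of `vol_of_counts`: determinant coefficient `2·(x(1+(1−x)⁻¹)∕2)` on `|Λ|`, `2K₀α₄` on `#⋃𝐃`, `A·c_E` on `|Λ|`, `A·V` on `|Λ ⊕ C₀|`) is
`≤ a₅·|Z|` as soon as the three sizes are at most `V·|Z|` and the DIALS are small against `a₅∕V`: `4V(3Q + 2DQ′)·θ₀ ≤ a₅`, `8VD·γ₂ ≤ a₅`,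
`8VD·(2m′α₄M⁻⁴(1+32∕(κ₁−1))⁴) ≤ a₅`, `8V·K₀α₄ ≤ a₅` (each a quarter of the budget) (`Q = coefQ`, `Q′ = coefQ'`, `D = dSum`; `θ₀ ≤ θ₀max` only to have `x ≤ ½`).  p. 20: the volume letter is
«O(1)(LM)⁴α₅» — a COUNT times a SMALL dial. [cite: Balaban1988RG2Cluster, (2.24)–(2.26) p.17, p.20 (before (2.37))] -/
theorem vol_of_dials (hκ : 0 < κs) (hKCs : 0 ≤ KCs) (hθ₀ : 0 ≤ θ₀) (hcE : 0 ≤ cE) (hcV : 0 ≤ cV)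
    (hc0 : 0 ≤ c0η) (hmA : 0 < mA) (hγ₂ : 0 ≤ γ₂) (hα₄ : 0 ≤ α₄) (hM : 1 ≤ M) (hκ₁ : 1 < κ₁)
    (hθle : θ₀ ≤ theta0Max m ν κs KG KCs cE BΓ cV c0η mA)
    {K0 a₅ Λc ΛCc Uc Zc V : ℝ} (hK0 : 0 ≤ K0) (hΛc : 0 ≤ Λc) (hZc : 0 ≤ Zc) (hV : 0 ≤ V)
    (hΛV : Λc ≤ V * Zc) (hΛCV : ΛCc ≤ V * Zc) (hUV : Uc ≤ V * Zc)
    (hθvol : 4 * V * (3 * coefQ m ν κs KG KCs + 2 * (dSum m ν cE BΓ cV c0η mA * coefQ' m ν κs KG KCs)) * θ₀ ≤ a₅)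
    (hγvol : 8 * V * dSum m ν cE BΓ cV c0η mA * γ₂ ≤ a₅)
    (hαM : 8 * V * dSum m ν cE BΓ cV c0η mA * (2 * ((m' : ℝ) * α₄ * (M ^ 4)⁻¹ * (1 + 32 / (κ₁ - 1)) ^ 4)) ≤ a₅)
    (hαK : 8 * V * (K0 * α₄) ≤ a₅) :
    2 * (KCs * ((m : ℝ) * (1 + 2 / chainRate 3 κs) ^ ν) * (theta m ν κs KG KCs θ₀ * ((m : ℝ) * (1 + 2 / chainRate 1 κs) ^ ν))
            * (1 + (1 - KCs * ((m : ℝ) * (1 + 2 / chainRate 3 κs) ^ ν)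
              * (theta m ν κs KG KCs θ₀ * ((m : ℝ) * (1 + 2 / chainRate 1 κs) ^ ν)))⁻¹) / 2) * Λc
        + 2 * (K0 * α₄ * Uc)
        + (2 * (theta m ν κs KG KCs θ₀ * ((m : ℝ) * (1 + 2 / chainRate 1 κs) ^ ν))
            + (γ₂ + 2 * ((m' : ℝ) * α₄ * (M ^ 4)⁻¹ * (1 + 32 / (κ₁ - 1)) ^ 4))) * cE * Λc
        + (2 * (theta m ν κs KG KCs θ₀ * ((m : ℝ) * (1 + 2 / chainRate 1 κs) ^ ν))
            + (γ₂ + 2 * ((m' : ℝ) * α₄ * (M ^ 4)⁻¹ * (1 + 32 / (κ₁ - 1)) ^ 4)))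
            * (1 + 2 * cE * (BΓ * cV * (BΓ * ((m : ℝ) * c0η ^ ν)) / (mA / 2))) * ΛCc
      ≤ a₅ * Zc := by
  -- letters
  obtain ⟨hx0, hxQ⟩ := smallKθ_le m ν (KG := KG) hκ hKCs hθ₀
  obtain ⟨hxh, -⟩ := hsmallKθ_numerals m ν (KG := KG) (BΓ := BΓ) hκ hKCs hθ₀ hcE hcV hc0 hmA hθle
  have hQ := coefQ_nonneg m ν (κs := κs) (KG := KG) hKCs
  have hQ' := coefQ'_nonneg m ν (KG := KG) (KCs := KCs) hκ
  obtain ⟨hD, hcD, hVD⟩ := dSum_pos_and_le m ν (BΓ := BΓ) hcE hcV hc0 hmA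
  set x := KCs * ((m : ℝ) * (1 + 2 / chainRate 3 κs) ^ ν)
    * (theta m ν κs KG KCs θ₀ * ((m : ℝ) * (1 + 2 / chainRate 1 κs) ^ ν)) with hx_def
  set Q := coefQ m ν κs KG KCs with hQ_def
  set Q' := coefQ' m ν κs KG KCs with hQ'_def
  set D := dSum m ν cE BΓ cV c0η mA with hD_def
  set Vf := 1 + 2 * cE * (BΓ * cV * (BΓ * ((m : ℝ) * c0η ^ ν)) / (mA / 2)) with hVf_def
  have hVf : Vf = volFac m ν cE BΓ cV c0η mA := rfl
  have hVfD : Vf ≤ D := hVf ▸ hVD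
  set a20 := 2 * ((m' : ℝ) * α₄ * (M ^ 4)⁻¹ * (1 + 32 / (κ₁ - 1)) ^ 4) with ha20_def
  have ha20 : 0 ≤ a20 := by
    have : 0 < κ₁ - 1 := by linarith
    positivity
  -- the letter `A = θ₀Q′ + γ₂ + a₂₀`
  have hA_eq : 2 * (theta m ν κs KG KCs θ₀ * ((m : ℝ) * (1 + 2 / chainRate 1 κs) ^ ν)) + (γ₂ + a20) = θ₀ * Q' + γ₂ + a20 := by
    rw [two_theta_fib_eq]
    ring
  set A := 2 * (theta m ν κs KG KCs θ₀ * ((m : ℝ) * (1 + 2 / chainRate 1 κs) ^ ν)) + (γ₂ + a20) with hA_def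
  have hA0 : 0 ≤ A := by rw [hA_eq]; positivity
  -- (i) determinant term
  have hdet : 2 * (x * (1 + (1 - x)⁻¹) / 2) ≤ 3 * x := detCoeff_le hx0 hxh
  have h1 : 2 * (x * (1 + (1 - x)⁻¹) / 2) * Λc ≤ 3 * (θ₀ * Q) * (V * Zc) := by
    calc 2 * (x * (1 + (1 - x)⁻¹) / 2) * Λc ≤ (3 * x) * Λc := mul_le_mul_of_nonneg_right hdet hΛc
      _ ≤ (3 * (θ₀ * Q)) * Λc := mul_le_mul_of_nonneg_right (by linarith) hΛc
      _ ≤ 3 * (θ₀ * Q) * (V * Zc) := mul_le_mul_of_nonneg_left hΛV (by positivity)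
  -- (ii) the 𝐃-count term
  have h2 : 2 * (K0 * α₄ * Uc) ≤ 2 * (K0 * α₄) * (V * Zc) := by
    have : K0 * α₄ * Uc ≤ K0 * α₄ * (V * Zc) := mul_le_mul_of_nonneg_left hUV (by positivity)
    linarith
  -- (iii) the covariance term
  have h3 : A * cE * Λc ≤ A * cE * (V * Zc) := mul_le_mul_of_nonneg_left hΛV (by positivity)
  -- (iv) the Γ₀-form term
  have h4 : A * Vf * ΛCc ≤ A * D * (V * Zc) := by
    calc A * Vf * ΛCc ≤ A * Vf * (V * Zc) := by
          have hVf0 : 0 ≤ Vf := le_trans (by norm_num) (hVf ▸ one_le_volFac m ν (BΓ := BΓ) hcE hcV hc0 hmA)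
          exact mul_le_mul_of_nonneg_left hΛCV (by positivity)
      _ ≤ A * D * (V * Zc) := by
          have : A * Vf ≤ A * D := mul_le_mul_of_nonneg_left hVfD hA0
          exact mul_le_mul_of_nonneg_right this (by positivity)
  have hcED : A * cE ≤ A * D := mul_le_mul_of_nonneg_left hcD hA0
  have h3' : A * cE * (V * Zc) ≤ A * D * (V * Zc) := mul_le_mul_of_nonneg_right hcED (by positivity)
  -- the dial budget: `V·(3θ₀Q + 2K0α₄ + 2AD) ≤ a₅`
  have hAD : A * D = θ₀ * Q' * D + γ₂ * D + a20 * D := by rw [hA_eq]; ring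
  have hbudget : (3 * (θ₀ * Q) + 2 * (K0 * α₄) + 2 * (A * D)) * V ≤ a₅ := by
    -- atoms
    have e0 : (3 * (θ₀ * Q) + 2 * (K0 * α₄) + 2 * (A * D)) * V
        = 3 * (θ₀ * Q * V) + 2 * (θ₀ * Q' * D * V) + 2 * (γ₂ * D * V) + 2 * (a20 * D * V) + 2 * (K0 * α₄ * V) := by
      rw [hAD]; ring
    have e1 : 4 * V * (3 * Q + 2 * (D * Q')) * θ₀ = 12 * (θ₀ * Q * V) + 8 * (θ₀ * Q' * D * V) := by ring
    have e2 : 8 * V * D * γ₂ = 8 * (γ₂ * D * V) := by ring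
    have e3 : 8 * V * D * a20 = 8 * (a20 * D * V) := by ring
    have e4 : 8 * V * (K0 * α₄) = 8 * (K0 * α₄ * V) := by ring
    rw [e1] at hθvol; rw [e2] at hγvol; rw [e3] at hαM; rw [e4] at hαK
    rw [e0]
    linarith
  -- assemble
  have htot : 2 * (x * (1 + (1 - x)⁻¹) / 2) * Λc + 2 * (K0 * α₄ * Uc) + A * cE * Λc + A * Vf * ΛCc
      ≤ (3 * (θ₀ * Q) + 2 * (K0 * α₄) + 2 * (A * D)) * V * Zc := by
    have := add_le_add (add_le_add (add_le_add h1 h2) (le_trans h3 h3')) h4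
    have e : 3 * (θ₀ * Q) * (V * Zc) + 2 * (K0 * α₄) * (V * Zc) + A * D * (V * Zc) + A * D * (V * Zc)
        = (3 * (θ₀ * Q) + 2 * (K0 * α₄) + 2 * (A * D)) * V * Zc := by ring
    linarith
  calc _ = 2 * (x * (1 + (1 - x)⁻¹) / 2) * Λc + 2 * (K0 * α₄ * Uc) + A * cE * Λc + A * Vf * ΛCc := by
        rw [hx_def, hA_def, ha20_def, hVf_def]
    _ ≤ (3 * (θ₀ * Q) + 2 * (K0 * α₄) + 2 * (A * D)) * V * Zc := htot
    _ ≤ a₅ * Zc := mul_le_mul_of_nonneg_right hbudget hZc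

end Volume

/-! ## §2. A6: the four dial inequalities are met by small positive dials, together with `θ₀ ≤ θ₀max`, `γ₂ ≤ γ₂max` -/

section Witness

variable (m ν m' : ℕ) {κs KG KCs cE BΓ cV c0η mA M κ₁ : ℝ}

/-- ★ **SMALL DIALS EXIST FOR EVERY SIZE LETTER.**  For every `V ≥ 0`, every `a₅ > 0`, every `K0 ≥ 0`, `M > 0`, `κ₁ > 1` and signed numeral letters there are
`θ₀ > 0`, `γ₂ > 0`, `α₄ > 0` with `θ₀ ≤ θ₀max`, `γ₂ ≤ γ₂max` AND the four dial inequalities of `vol_of_dials` — so the dial-weighted volume binder is met at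
ANY per-cube object size, by dials alone (p. 20 «sufficiently small»; contrast `B13CountBinderObstruction`: the frozen count pins `δκ > 1280M⁴L³`).
[cite: Balaban1988RG2Cluster, (2.24)–(2.26) p.17, p.20 (before (2.37))] -/
theorem exists_dials_vol (hκ : 0 < κs) (hKCs : 0 ≤ KCs) (hcE : 0 ≤ cE) (hcV : 0 ≤ cV) (hc0 : 0 ≤ c0η) (hmA : 0 < mA)
    (hM : 0 < M) (hκ₁ : 1 < κ₁) {K0 a₅ V : ℝ} (hK0 : 0 ≤ K0) (ha₅ : 0 < a₅) (hV : 0 ≤ V) :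
    ∃ θ₀ γ₂ α₄ : ℝ, 0 < θ₀ ∧ 0 < γ₂ ∧ 0 < α₄ ∧
      θ₀ ≤ theta0Max m ν κs KG KCs cE BΓ cV c0η mA ∧ γ₂ ≤ gamma2Max m ν cE BΓ cV c0η mA ∧
      4 * V * (3 * coefQ m ν κs KG KCs + 2 * (dSum m ν cE BΓ cV c0η mA * coefQ' m ν κs KG KCs)) * θ₀ ≤ a₅ ∧
      8 * V * dSum m ν cE BΓ cV c0η mA * γ₂ ≤ a₅ ∧
      8 * V * dSum m ν cE BΓ cV c0η mA * (2 * ((m' : ℝ) * α₄ * (M ^ 4)⁻¹ * (1 + 32 / (κ₁ - 1)) ^ 4)) ≤ a₅ ∧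
      8 * V * (K0 * α₄) ≤ a₅ := by
  have hQ := coefQ_nonneg m ν (κs := κs) (KG := KG) hKCs
  have hQ' := coefQ'_nonneg m ν (KG := KG) (KCs := KCs) hκ
  obtain ⟨hD, -, -⟩ := dSum_pos_and_le m ν (BΓ := BΓ) hcE hcV hc0 hmA
  have hθmax := theta0Max_pos m ν (BΓ := BΓ) hκ hKCs (KG := KG) hcE hcV hc0 hmA
  have hγmax : 0 < gamma2Max m ν cE BΓ cV c0η mA := by unfold gamma2Max; positivity
  have hk : 0 < κ₁ - 1 := by linarith
  -- denominators (all ≥ 1 after adding 1)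
  have hm' : 0 ≤ 2 * ((m' : ℝ) * (M ^ 4)⁻¹ * (1 + 32 / (κ₁ - 1)) ^ 4) := by positivity
  have hc₁ : 0 ≤ 4 * V * (3 * coefQ m ν κs KG KCs + 2 * (dSum m ν cE BΓ cV c0η mA * coefQ' m ν κs KG KCs)) := by
    have := mul_nonneg hD.le hQ'
    positivity
  have hc₂ : 0 ≤ 8 * V * dSum m ν cE BΓ cV c0η mA := by positivity
  have hc₃ : 0 ≤ 8 * V * dSum m ν cE BΓ cV c0η mA * (2 * ((m' : ℝ) * (M ^ 4)⁻¹ * (1 + 32 / (κ₁ - 1)) ^ 4)) + 8 * V * K0 := by positivity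
  set d₁ := 4 * V * (3 * coefQ m ν κs KG KCs + 2 * (dSum m ν cE BΓ cV c0η mA * coefQ' m ν κs KG KCs)) + 1 with hd₁
  set d₂ := 8 * V * dSum m ν cE BΓ cV c0η mA + 1 with hd₂
  set d₃ := 8 * V * dSum m ν cE BΓ cV c0η mA * (2 * ((m' : ℝ) * (M ^ 4)⁻¹ * (1 + 32 / (κ₁ - 1)) ^ 4)) + 8 * V * K0 + 1 with hd₃
  have hd₁p : 1 ≤ d₁ := by rw [hd₁]; linarith
  have hd₂p : 1 ≤ d₂ := by rw [hd₂]; linarith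
  have hd₃p : 1 ≤ d₃ := by rw [hd₃]; linarith
  refine ⟨min (theta0Max m ν κs KG KCs cE BΓ cV c0η mA) (a₅ / d₁), min (gamma2Max m ν cE BΓ cV c0η mA) (a₅ / d₂), a₅ / d₃,
    lt_min hθmax (by positivity), lt_min hγmax (by positivity), by positivity, min_le_left _ _, min_le_left _ _, ?_, ?_, ?_, ?_⟩
  · -- θ₀
    have hle : min (theta0Max m ν κs KG KCs cE BΓ cV c0η mA) (a₅ / d₁) ≤ a₅ / d₁ := min_le_right _ _
    calc 4 * V * (3 * coefQ m ν κs KG KCs + 2 * (dSum m ν cE BΓ cV c0η mA * coefQ' m ν κs KG KCs))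
          * min (theta0Max m ν κs KG KCs cE BΓ cV c0η mA) (a₅ / d₁)
        ≤ 4 * V * (3 * coefQ m ν κs KG KCs + 2 * (dSum m ν cE BΓ cV c0η mA * coefQ' m ν κs KG KCs)) * (a₅ / d₁) :=
          mul_le_mul_of_nonneg_left hle hc₁
      _ ≤ d₁ * (a₅ / d₁) := mul_le_mul_of_nonneg_right (by rw [hd₁]; linarith) (by positivity)
      _ = a₅ := by field_simp
  · -- γ₂
    have hle : min (gamma2Max m ν cE BΓ cV c0η mA) (a₅ / d₂) ≤ a₅ / d₂ := min_le_right _ _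
    calc 8 * V * dSum m ν cE BΓ cV c0η mA * min (gamma2Max m ν cE BΓ cV c0η mA) (a₅ / d₂)
        ≤ 8 * V * dSum m ν cE BΓ cV c0η mA * (a₅ / d₂) := mul_le_mul_of_nonneg_left hle hc₂
      _ ≤ d₂ * (a₅ / d₂) := mul_le_mul_of_nonneg_right (by rw [hd₂]; linarith) (by positivity)
      _ = a₅ := by field_simp
  · -- α₄ (the M⁻⁴ term)
    have e : 8 * V * dSum m ν cE BΓ cV c0η mA * (2 * ((m' : ℝ) * (a₅ / d₃) * (M ^ 4)⁻¹ * (1 + 32 / (κ₁ - 1)) ^ 4))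
        = (8 * V * dSum m ν cE BΓ cV c0η mA * (2 * ((m' : ℝ) * (M ^ 4)⁻¹ * (1 + 32 / (κ₁ - 1)) ^ 4))) * (a₅ / d₃) := by ring
    rw [e]
    have hVK : 0 ≤ 8 * V * K0 := by positivity
    calc (8 * V * dSum m ν cE BΓ cV c0η mA * (2 * ((m' : ℝ) * (M ^ 4)⁻¹ * (1 + 32 / (κ₁ - 1)) ^ 4))) * (a₅ / d₃)
        ≤ d₃ * (a₅ / d₃) := by
          refine mul_le_mul_of_nonneg_right ?_ (by positivity)
          rw [hd₃]; linarith
      _ = a₅ := by field_simp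
  · -- α₄ (the K₀ term)
    have e : 8 * V * (K0 * (a₅ / d₃)) = (8 * V * K0) * (a₅ / d₃) := by ring
    rw [e]
    have hVD : 0 ≤ 8 * V * dSum m ν cE BΓ cV c0η mA * (2 * ((m' : ℝ) * (M ^ 4)⁻¹ * (1 + 32 / (κ₁ - 1)) ^ 4)) := by positivity
    calc (8 * V * K0) * (a₅ / d₃) ≤ d₃ * (a₅ / d₃) := by
          refine mul_le_mul_of_nonneg_right ?_ (by positivity)
          rw [hd₃]; linarith
      _ = a₅ := by field_simp

end Witness

end Literature.MathematicalPhysics.QuantumFieldTheory.Balaban1983to89.B13VolumeDialNumerals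

end
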